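import Literature.Geometry.Riemannian.RicciFlowSpatialRicciBounds
import Literature.Geometry.Riemannian.RicciFlowShortTimeProofs
import HarnessLib

/-!
# Discharged fact: curvature blows up at a finite maximal time of the Ricci flow
# (Hamilton 1982, Thm. 14.1; Topping 2006, Thm. 5.3.1)

`Literature.Geometry.Riemannian.ricciFlow_curvature_blowup` (`Riemannian/RicciFlowMaximal`: if the
Ricci flow on a closed manifold exists on a maximal interval `[0, T)` with `T < ∞` then
`sup_M |Rm|(·, t) → ∞` as `t ↑ T`; users take it as `(h : ricciFlow_curvature_blowup)`) was reduced
in the tree to the short-time existence theorem `ricciFlow_shortTime_existence` (Hamilton 1982 /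
DeTurck; Topping Thm. 5.2.1) by `ricciFlow_curvature_blowup_of_shortTime`
(`Riemannian/RicciFlowSpatialRicciBounds`; every other step of the printed proof — curvature
doubling, Shi's global derivative estimates, metric equivalence, the smooth extension to `[0, T]`,
the junction at `t = T` and the contradiction with maximality — being proved there).  Short-time
existence is a theorem of the tree (`ricciFlow_shortTime_existence_holds`,
`Riemannian/RicciFlowShortTimeProofs`, via the Ricci–DeTurck trick and the quasilinear parabolic
theory of `Analysis/PDE/QuasilinearFinal`), so the fact is discharged by the one-line application
below.  No statement is changed; no definition, no new named fact (D-0026); net Literature debt **−1**.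

## References

* R. S. Hamilton, *Three-manifolds with positive Ricci curvature*, J. Differential Geom. 17 (1982)
  255–306, §14, Thm. 14.1 (p. 296). [Hamilton1982]
* P. Topping, *Lectures on the Ricci flow*, LMS Lecture Note Series 325 (2006), Thm. 5.2.1,
  Thm. 5.3.1 with its proof (pp. 46–48). [Topping2006]
-/

namespace Literature.Geometry.Riemannian

universe u v w

/-- **Hamilton 1982, Thm. 14.1 / Topping 2006, Thm. 5.3.1: if `T < ∞` is the maximal time of a Ricci
flow on a closed manifold then the curvature blows up as `t ↑ T` — the named fact
`ricciFlow_curvature_blowup` holds** (`ricciFlow_curvature_blowup_of_shortTime` applied to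
`ricciFlow_shortTime_existence_holds`).
[cite: Topping2006, Thm. 5.3.1 (proof, pp. 46–48)] [cite: Hamilton1982, §14, Thm. 14.1 (p. 296)] -/
theorem ricciFlow_curvature_blowup_holds : ricciFlow_curvature_blowup.{u, v, w} :=
  ricciFlow_curvature_blowup_of_shortTime ricciFlow_shortTime_existence_holds

end Literature.Geometry.Riemannian
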